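import Summits.QuantumFields.YangMills.Theorems.LuscherReductionTwistedTraceScalingValleyBOUpper
import Mathlib.Analysis.CStarAlgebra.ContinuousFunctionalCalculus.Continuity
import Mathlib.Analysis.Matrix.Order
import HarnessLib

/-!
# Lane B's hypothesis (m5) DISCHARGED: the Riccati trial state `stiffTrial (riccatiWeight t b μ)` is CONTINUOUS, hence measurable
# (lane A of S-BASE, crux `TwistedTraceScaling` stmt-QuantumFields-20203; design note `pub/ym-fleet/ym-luscher-20007-p1/COARSE-DESIGN.md` §17)

Every theorem of lane B's covariant super-solution chain (`Cov.transferApply_stiffTrial_le`, `…_riccatiTrial_le`, `…_le_zpe`, `valleyBOUpperAt_of_riccati`) carries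
the hypothesis `Measurable (stiffTrial g)`.  For the programme's weight `g = riccatiWeight t b μ` (`μ > 0`; indeed for every CONTINUOUS `g`) it holds:
* `continuous_adRot`, `continuous_hol'`, `continuous_plaqCurv`, `continuous_covCurl_apply` — the pieces are polynomial in the links;
* `gramMatrix_apply` (`(Gram D)_{ij} = ⟨D eᵢ, D eⱼ⟩`), `continuous_gramMatrix_covCurl`, `continuous_adjoint_covCurl_plaqCurv`;
* `gram_spectrum_subset` — the spectrum of the Gram matrix of `D_U` lies in `[0, (10√N)²]` uniformly in `U`;
* ★ `continuous_spectralWeight_covCurl` — `U ↦ g(D_U†D_U)` is continuous for `g` continuous on `[0,(10√N)²]` (Mathlib's `continuousOn_cfc` for the isometric matrix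
  functional calculus, operator norm);
* ★★ `continuous_stiffTrial`, `measurable_stiffTrial` — for continuous `g`; ★★ `continuous_riccatiWeight`, `measurable_stiffTrial_riccati` — (m5) for the Riccati weight.
HONEST FRAMING: measurability bookkeeping for a stub lane of a child of the CONDITIONAL reduction route (femto rung R2b1); not infinite volume, not a gap, not Clay.
-/

set_option autoImplicit false

noncomputable section

open MeasureTheory Real Matrix
open scoped BigOperators RealInnerProductSpace
open Literature.MathematicalPhysics.QuantumFieldTheory
open Literature.MathematicalPhysics.QuantumLattice

namespace Summit.QuantumFields.YangMills.Theorems.FemtoTransferGap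

open TwoLattice TwoLattice.Cov TwoLattice.Stiff TwoLattice.Harm

variable {L : ℕ} [NeZero L]

/-! ## §1 Continuity of the pieces -/

/-- `V ↦ Ad(V)` is continuous on `SU(2)` (quadratic in the matrix entries). [folklore] -/
theorem continuous_adRot : Continuous (fun V : SU2 => adRot V) := by
  have hp : Continuous fun V : SU2 => ((V : Matrix (Fin 2) (Fin 2) ℂ) 0 0).re := Complex.continuous_re.comp (continuous_su2_apply 0 0)
  have hq : Continuous fun V : SU2 => ((V : Matrix (Fin 2) (Fin 2) ℂ) 0 0).im := Complex.continuous_im.comp (continuous_su2_apply 0 0)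
  have hr : Continuous fun V : SU2 => ((V : Matrix (Fin 2) (Fin 2) ℂ) 0 1).re := Complex.continuous_re.comp (continuous_su2_apply 0 1)
  have hs : Continuous fun V : SU2 => ((V : Matrix (Fin 2) (Fin 2) ℂ) 0 1).im := Complex.continuous_im.comp (continuous_su2_apply 0 1)
  refine continuous_matrix fun i j => ?_
  fin_cases i <;> fin_cases j <;> simp [adRot] <;> fun_prop

omit [NeZero L] in
/-- `U ↦ hol_p(U)` is continuous. [folklore] -/
theorem continuous_hol' (p : Plaquette 3 L) : Continuous fun U : GaugeConfig 3 L SU2 => hol U p := by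
  unfold hol plaquetteHolonomy; fun_prop

omit [NeZero L] in
/-- `U ↦ P₁(U) = U(x,i)` is continuous. [folklore] -/
theorem continuous_ptrans1 (p : Plaquette 3 L) : Continuous fun U : GaugeConfig 3 L SU2 => ptrans1 U p := by
  unfold ptrans1; fun_prop

omit [NeZero L] in
/-- `U ↦ P₂(U)` is continuous. [folklore] -/
theorem continuous_ptrans2 (p : Plaquette 3 L) : Continuous fun U : GaugeConfig 3 L SU2 => ptrans2 U p := by
  unfold ptrans2; fun_prop

omit [NeZero L] in
/-- `U ↦ F(U) = plaqCurv U` is continuous. [folklore] -/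
theorem continuous_plaqCurv : Continuous fun U : GaugeConfig 3 L SU2 => plaqCurv U := by
  unfold plaqCurv
  refine (PiLp.continuous_toLp 2 _).comp (continuous_pi fun pa => ?_)
  exact (continuous_apply pa.2).comp (continuous_vecPart.comp (continuous_hol' pa.1))

omit [NeZero L] in
/-- `U ↦ D_U w` is continuous for every fixed `w`. [folklore] -/
theorem continuous_covCurl_apply (w : LinkSpace L) : Continuous fun U : GaugeConfig 3 L SU2 => covCurl U w := by
  have hco : ∀ q : Plaquette 3 L × Fin 3, Continuous fun U : GaugeConfig 3 L SU2 => (covCurl U w) q := fun q => by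
    obtain ⟨⟨x, ij⟩, a⟩ := q
    simp only [covCurl_apply]
    have h1 := continuous_adRot.comp (continuous_ptrans1 (L := L) (x, ij))
    have h2 := continuous_adRot.comp (continuous_ptrans2 (L := L) (x, ij))
    have h3 := continuous_adRot.comp (continuous_hol' (L := L) (x, ij))
    refine ((continuous_const.add (continuous_finsetSum _ fun b _ => ?_)).sub (continuous_finsetSum _ fun b _ => ?_)).sub
      (continuous_finsetSum _ fun b _ => ?_)
    · exact ((continuous_apply_apply a b).comp h1).mul continuous_const
    · exact ((continuous_apply_apply a b).comp h2).mul continuous_const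
    · exact ((continuous_apply_apply a b).comp h3).mul continuous_const
  have h : (fun U : GaugeConfig 3 L SU2 => covCurl U w) = fun U => WithLp.toLp 2 (fun q => (covCurl U w) q) := by
    funext U; rfl
  rw [h]
  exact (PiLp.continuous_toLp 2 _).comp (continuous_pi hco)

/-! ## §2 The Gram matrix and the adjoint as continuous functions of `U` -/

/-- Entries of the Gram matrix: `(Gram D)_{ij} = ⟨D eᵢ, D eⱼ⟩` on the standard basis. [cite: HornJohnson2013, Thm 7.3.2] -/
theorem gramMatrix_apply {n : Type*} [Fintype n] [DecidableEq n] {W : Type*} [NormedAddCommGroup W] [InnerProductSpace ℝ W]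
    [FiniteDimensional ℝ W] (D : EuclideanSpace ℝ n →ₗ[ℝ] W) (i j : n) :
    gramMatrix D i j = ⟪D (EuclideanSpace.single i 1), D (EuclideanSpace.single j 1)⟫ := by
  have h := toEuclideanLin_gramMatrix_apply D (EuclideanSpace.single j 1)
  have h2 : ⟪EuclideanSpace.single i (1 : ℝ), Matrix.toEuclideanLin (gramMatrix D) (EuclideanSpace.single j 1)⟫ =
      ⟪EuclideanSpace.single i (1 : ℝ), D.adjoint (D (EuclideanSpace.single j 1))⟫ := by rw [h]
  rw [LinearMap.adjoint_inner_right, EuclideanSpace.inner_single_left] at h2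
  simp only [map_one, one_mul] at h2
  rw [← h2]
  simp [Matrix.toLpLin_apply, EuclideanSpace.single]

/-- `U ↦ Gram(D_U)` is continuous. [folklore] -/
theorem continuous_gramMatrix_covCurl : Continuous fun U : GaugeConfig 3 L SU2 => gramMatrix (covCurl U) := by
  refine continuous_matrix fun i j => ?_
  simp only [gramMatrix_apply]
  exact (continuous_covCurl_apply _).inner (continuous_covCurl_apply _)

/-- `U ↦ D_U† F(U)` is continuous. [folklore] -/
theorem continuous_adjoint_covCurl_plaqCurv : Continuous fun U : GaugeConfig 3 L SU2 => (covCurl U).adjoint (plaqCurv U) := by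
  have hco : ∀ i : Edge 3 L × Fin 3, Continuous fun U : GaugeConfig 3 L SU2 => ((covCurl U).adjoint (plaqCurv U)) i := fun i => by
    have h : ∀ U : GaugeConfig 3 L SU2, ((covCurl U).adjoint (plaqCurv U)) i = ⟪covCurl U (EuclideanSpace.single i 1), plaqCurv U⟫ := fun U => by
      rw [← LinearMap.adjoint_inner_right, EuclideanSpace.inner_single_left]; simp
    simp only [h]
    exact (continuous_covCurl_apply _).inner continuous_plaqCurv
  have h : (fun U : GaugeConfig 3 L SU2 => (covCurl U).adjoint (plaqCurv U)) =
      fun U => WithLp.toLp 2 (fun i => ((covCurl U).adjoint (plaqCurv U)) i) := by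
    funext U; rfl
  rw [h]
  exact (PiLp.continuous_toLp 2 _).comp (continuous_pi hco)

/-! ## §3 The spectral weight is continuous in `U` -/

/-- The spectrum of the Gram matrix of `D_U` lies in `[0, (10√N)²]`, `N = 3|P|`. [cite: HornJohnson2013, Thm 7.3.2] -/
theorem gram_spectrum_subset (U : GaugeConfig 3 L SU2) :
    spectrum ℝ (gramMatrix (covCurl U)) ⊆ Set.Icc 0 ((10 * Real.sqrt (Fintype.card (Plaquette 3 L × Fin 3))) ^ 2) := by
  classical
  rw [(gramMatrix_isHermitian (covCurl U)).spectrum_real_eq_range_eigenvalues]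
  rintro x ⟨i, rfl⟩
  refine ⟨gram_eigenvalues_nonneg (covCurl U) i, ?_⟩
  have hv := Frame.IsDiag.value_eq_norm_sq (Frame.isDiag_gramEigenvectorBasis (covCurl U)) i
  rw [hv]
  have hn := norm_covCurl_le_op U ((gramMatrix_isHermitian (covCurl U)).eigenvectorBasis i)
  rw [((gramMatrix_isHermitian (covCurl U)).eigenvectorBasis).orthonormal.1 i, mul_one] at hn
  exact pow_le_pow_left₀ (norm_nonneg _) hn 2

section CFC

open scoped Matrix.Norms.L2Operator

/-- ★ **`U ↦ g(D_U†D_U)` is continuous** for `g` continuous on `[0, (10√N)²]` (isometric matrix functional calculus, operator norm; the topology is the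
product topology). [cite: HornJohnson2013, Thm 4.1.5] -/
theorem continuous_spectralWeight_covCurl {g : ℝ → ℝ}
    (hg : ContinuousOn g (Set.Icc 0 ((10 * Real.sqrt (Fintype.card (Plaquette 3 L × Fin 3))) ^ 2))) :
    Continuous fun U : GaugeConfig 3 L SU2 => spectralWeight g (covCurl U) := by
  have hs : IsCompact (Set.Icc (0 : ℝ) ((10 * Real.sqrt (Fintype.card (Plaquette 3 L × Fin 3))) ^ 2)) := isCompact_Icc
  have hc := continuousOn_cfc (Matrix (Edge 3 L × Fin 3) (Edge 3 L × Fin 3) ℝ) hs g hg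
  have hmap : ∀ U : GaugeConfig 3 L SU2, gramMatrix (covCurl U) ∈
      {a : Matrix (Edge 3 L × Fin 3) (Edge 3 L × Fin 3) ℝ | IsSelfAdjoint a ∧
        spectrum ℝ a ⊆ Set.Icc 0 ((10 * Real.sqrt (Fintype.card (Plaquette 3 L × Fin 3))) ^ 2)} :=
    fun U => ⟨gramMatrix_isSelfAdjoint (covCurl U), gram_spectrum_subset U⟩
  show Continuous fun U : GaugeConfig 3 L SU2 => cfc g (gramMatrix (covCurl U))
  exact hc.comp_continuous continuous_gramMatrix_covCurl hmap

end CFC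

/-! ## §4 ★★ The trial state is continuous, hence measurable -/

/-- ★★ **`stiffTrial g` is continuous** for `g` continuous on `[0, (10√N)²]`. [cite: Luscher1983, §3] -/
theorem continuous_stiffTrial {g : ℝ → ℝ} (hg : ContinuousOn g (Set.Icc 0 ((10 * Real.sqrt (Fintype.card (Plaquette 3 L × Fin 3))) ^ 2))) :
    Continuous (stiffTrial (L := L) g) := by
  unfold stiffTrial weightForm spectralWeightLin
  refine Real.continuous_exp.comp (Continuous.neg ?_)
  refine continuous_adjoint_covCurl_plaqCurv.inner ?_
  -- `U ↦ toEuclideanLin (g(Gram_U)) (D_U† F_U) = toLp (g(Gram_U) *ᵥ ofLp (D_U† F_U))`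
  have h : (fun U : GaugeConfig 3 L SU2 => Matrix.toEuclideanLin (spectralWeight g (covCurl U)) ((covCurl U).adjoint (plaqCurv U))) =
      fun U => WithLp.toLp 2 (spectralWeight g (covCurl U) *ᵥ WithLp.ofLp ((covCurl U).adjoint (plaqCurv U))) := by
    funext U; rfl
  rw [h]
  exact (PiLp.continuous_toLp 2 _).comp
    ((continuous_spectralWeight_covCurl hg).matrix_mulVec ((PiLp.continuous_ofLp 2 _).comp continuous_adjoint_covCurl_plaqCurv))

/-- ★★ **`stiffTrial g` is measurable** for `g` continuous on `[0, (10√N)²]`. [cite: Luscher1983, §3] -/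
theorem measurable_stiffTrial {g : ℝ → ℝ} (hg : ContinuousOn g (Set.Icc 0 ((10 * Real.sqrt (Fintype.card (Plaquette 3 L × Fin 3))) ^ 2))) :
    Measurable (stiffTrial (L := L) g) := by
  haveI : SecondCountableTopology SU2 := secondCountableTopology_su2
  exact (continuous_stiffTrial hg).measurable

/-- ★★ The Riccati weight is continuous on `ℝ` (`μ > 0`). [cite: Wipf2021, §8.5.1 (8.57)] -/
theorem continuous_riccatiWeight (t b : ℝ) {μ : ℝ} (hμ : 0 < μ) : Continuous (riccatiWeight t b μ) := by
  unfold riccatiWeight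
  have hmax : Continuous fun lam : ℝ => max lam μ := continuous_id.max continuous_const
  have hne : ∀ lam : ℝ, max lam μ ≠ 0 := fun lam => (hμ.trans_le (le_max_right _ _)).ne'
  exact ((continuous_const.add (continuous_const.div hmax hne)).sqrt).div hmax hne

/-- ★★ **(m5) DISCHARGED**: `stiffTrial (riccatiWeight t b μ)` is measurable (`μ > 0`). [cite: Luscher1983, §3] [cite: Wipf2021, §8.5.1] -/
theorem measurable_stiffTrial_riccati (t b : ℝ) {μ : ℝ} (hμ : 0 < μ) : Measurable (stiffTrial (L := L) (riccatiWeight t b μ)) :=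
  measurable_stiffTrial (continuous_riccatiWeight t b hμ).continuousOn

end Summit.QuantumFields.YangMills.Theorems.FemtoTransferGap

end
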